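import Mathlib
import Summits.KontsevichZagierPeriods.Zeta5Search.Families.ExactAtlasReps
import Summits.KontsevichZagierPeriods.Zeta5Search.Families.BasicGrowthEightExact
import Summits.KontsevichZagierPeriods.Zeta5Search.Families.ExactS8bValue
import Summits.KontsevichZagierPeriods.Zeta5Search.Families.ExactS8cValue
import Summits.KontsevichZagierPeriods.Zeta5Search.Families.ExactS8dValue
import Summits.KontsevichZagierPeriods.Zeta5Search.Families.ExactS8eValue
import Summits.KontsevichZagierPeriods.Zeta5Search.Families.ExactS8fValue
import Summits.KontsevichZagierPeriods.Zeta5Search.Families.ExactS8gValue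
import Summits.KontsevichZagierPeriods.Zeta5Search.Families.ExactS8hValue
import Summits.KontsevichZagierPeriods.Zeta5Search.Families.ExactS8iValue
import Summits.KontsevichZagierPeriods.Zeta5Search.Families.ExactS8jValue
import Summits.KontsevichZagierPeriods.Zeta5Search.Families.ExactS8kValue
import Summits.KontsevichZagierPeriods.Zeta5Search.Families.ExactS8lValue
import Summits.KontsevichZagierPeriods.Zeta5Search.Families.ExactS8mValue
import Summits.KontsevichZagierPeriods.Zeta5Search.Families.ExactS8nValue
import Summits.KontsevichZagierPeriods.Zeta5Search.Families.ExactS8oValue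
import Summits.KontsevichZagierPeriods.Zeta5Search.Families.ExactS8pValue
import Summits.KontsevichZagierPeriods.Zeta5Search.Families.ExactS8qValue
import HarnessLib

/-!
# ζ(5) search — Families: the thirteen growth constants of the eight-point configurations

HONEST FRAMING: systematic search; no irrationality claim unless certified.  STRUCTURAL facts about the size of
Brown's basic cellular integrals [Brown2016, §1.5, App. 2 §10.1.4] (seat P2, Families layer); nothing about the
arithmetic of any zeta value.

`Families/ExactAtlasReps.lean` reads every convergent 8-plan off Brown's 17 classes; four pairs of INEQUIVALENT classes
share their growth constant (same minimal polynomial, same isolating bracket, hence the same root):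
`fSup_S8n_eq_fSup_S8e`, `fSup_S8o_eq_fSup_S8c`, `fSup_S8p_eq_fSup_S8j`, `fSup_S8q_eq_fSup_S8f`.  Consequently
**`fSup_ofSeating_eight_mem_thirteen`**: the growth constant of every convergent seating plan of eight guests is one of
THIRTEEN explicit algebraic numbers — `λ₁` (root of Brown–Zudilin's `χ`, `fSup_pi8dual_eq_of_charPoly`) and the roots
`minpoly_fSup_<Tag>` for the tags `S8b … S8m`.  Standard axioms only.
-/

noncomputable section

open MeasureTheory Set Finset Filter Topology
open Literature.NumberTheory.Irrationality.Brown2016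

namespace Summit.KontsevichZagierPeriods.Zeta5Search.Families.Cellular

/-- The inequivalent classes `sigmaS8n` and `sigmaS8e` have the same growth constant (same minimal polynomial and bracket). -/
theorem fSup_S8n_eq_fSup_S8e : fSup sigmaS8n = fSup sigmaS8e := by
  obtain ⟨lam, hmem, hχ, h⟩ := exists_fSup_S8e_eq
  have hχ' : minpolyS8n lam = 0 := by unfold minpolyS8n; unfold minpolyS8e at hχ; exact hχ
  rw [h]
  exact fSup_S8n_eq_of_root hχ' hmem.1 hmem.2

/-- The inequivalent classes `sigmaS8o` and `sigmaS8c` have the same growth constant (same minimal polynomial and bracket). -/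
theorem fSup_S8o_eq_fSup_S8c : fSup sigmaS8o = fSup sigmaS8c := by
  obtain ⟨lam, hmem, hχ, h⟩ := exists_fSup_S8c_eq
  have hχ' : minpolyS8o lam = 0 := by unfold minpolyS8o; unfold minpolyS8c at hχ; exact hχ
  rw [h]
  exact fSup_S8o_eq_of_root hχ' hmem.1 hmem.2

/-- The inequivalent classes `sigmaS8p` and `sigmaS8j` have the same growth constant (same minimal polynomial and bracket). -/
theorem fSup_S8p_eq_fSup_S8j : fSup sigmaS8p = fSup sigmaS8j := by
  obtain ⟨lam, hmem, hχ, h⟩ := exists_fSup_S8j_eq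
  have hχ' : minpolyS8p lam = 0 := by unfold minpolyS8p; unfold minpolyS8j at hχ; exact hχ
  rw [h]
  exact fSup_S8p_eq_of_root hχ' hmem.1 hmem.2

/-- The inequivalent classes `sigmaS8q` and `sigmaS8f` have the same growth constant (same minimal polynomial and bracket). -/
theorem fSup_S8q_eq_fSup_S8f : fSup sigmaS8q = fSup sigmaS8f := by
  obtain ⟨lam, hmem, hχ, h⟩ := exists_fSup_S8f_eq
  have hχ' : minpolyS8q lam = 0 := by unfold minpolyS8q; unfold minpolyS8f at hχ; exact hχ
  rw [h]
  exact fSup_S8q_eq_of_root hχ' hmem.1 hmem.2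

/-- **`N = 8`: the growth constant of every convergent seating plan of eight guests is one of THIRTEEN explicit
algebraic numbers** (`fSup pi8dual = λ₁` and the twelve roots `minpoly_fSup_S8b … minpoly_fSup_S8m`). -/
theorem fSup_ofSeating_eight_mem_thirteen {σ : List ℕ} (hσ : IsSeating 8 σ) (hc : IsConvergent 8 σ) :
    fSup (ofSeating (ℓ := 5) σ) ∈ [fSup pi8dual, fSup sigmaS8b, fSup sigmaS8c, fSup sigmaS8d, fSup sigmaS8e, fSup sigmaS8f, fSup sigmaS8g, fSup sigmaS8h, fSup sigmaS8i, fSup sigmaS8j, fSup sigmaS8k, fSup sigmaS8l, fSup sigmaS8m] := by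
  have h := fSup_ofSeating_eight_mem hσ hc
  rw [fSup_S8n_eq_fSup_S8e, fSup_S8o_eq_fSup_S8c, fSup_S8p_eq_fSup_S8j, fSup_S8q_eq_fSup_S8f] at h
  simp only [List.mem_cons, List.mem_nil_iff, or_false] at h ⊢
  rcases h with h | h | h | h | h | h | h | h | h | h | h | h | h | h | h | h | h <;> simp [h]

end Summit.KontsevichZagierPeriods.Zeta5Search.Families.Cellular
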